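import Summits.QuantumAdvantage.QuantumAdvantage.Theorems.CubicForrelationNearExactIsExactFlatRadicalPrep

/-!
# Crux `CubicForrelation.NearExactIsExact` (stmt-QuantumAdvantage-14043) — the RADICAL of a sign pattern that is quadratic along a
  flat is large when its 4-flat sums vanish `mod 8` (general `n`)

Certificate seat `b2b-cforr-cert` (gen 6).  HONEST FRAMING: an infrastructure theorem about Boolean functions on a coset `S = x₀ ⊕ V₀`
(`V₀ ∋ 0` `⊕`-closed) of `𝔽₂ⁿ` — input to the two-sided analysis of the boundary value `Φ = 31/32` on 16 bits; NOT summit progress.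

Setting: `h : 𝔽₂ⁿ → 𝔽₂`, `S = {P}` with `P x → a ∈ V₀ → P(x ⊕ a)` and `P x → x₀ ⊕ x ∈ V₀`, and
* (H3) every parametrised 3-flat sign sum `Σ_{ε∈𝔽₂³} (−1)^{h(x ⊕ ε·(a,b,c))}` with `x ∈ S`, `a,b,c ∈ V₀` is `≡ 0 (mod 4)`;
* (H4) every parametrised 4-flat sign sum with `x ∈ S` and directions in `V₀` is `≡ 0 (mod 8)`.
By (H3) the second differences `B(p,q)` of `h` along `V₀` are base-point free (`fr_hsd`), a symmetric alternating bi-additive form on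
`V₀`; let `R = {a ∈ V₀ : B(a,·) ≡ 0 on V₀}` be its radical.
* `fr_extract2`: if `4·#R < #V₀` there are `a₀,a₁,a₂,a₃ ∈ V₀` with `B(a₀,a₁) = B(a₂,a₃) = 1` and the four cross values `0` (pigeonhole
  inside `V₀` + Gram–Schmidt, as in the landed whole-space `ss_extract3`).
* `fr_radical_large`: **(H3) + (H4) ⇒ `#V₀ ≤ 4·#R`** — on the extracted 4-flat `h` is `ε₀ε₁ ⊕ ε₂ε₃ ⊕ affine`, whose sign sum is
  `±4 ≢ 0 (mod 8)`.
* `fr_radical_zero_mem`, `fr_radical_add`, `fr_radical_period`: `R ∋ 0` is `⊕`-closed and each `a ∈ R` is a period of `(−1)^h` on `S` up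
  to the sign `(−1)^{h(x₀)⊕h(x₀⊕a)}` — the input of the Fourier bound `fp_l1_sq_mul_le` (`…FourierPeriods.lean`).

References: F. J. MacWilliams, N. J. A. Sloane (1977) Ch. 15 §2; C. Carlet (2021) §5.2.  Everything below is proved from Mathlib and the
tree; axioms are the standard three.
-/

set_option linter.dupNamespace false -- D-0017: single-problem summit ⇒ `QuantumAdvantage.QuantumAdvantage` by design

noncomputable section

namespace Summit.QuantumAdvantage.QuantumAdvantage.Theorems.CubicForrelation.NearExactIsExact

open Finset
open Literature.Computability.QuantumComplexity
open Literature.Computability.QuantumComplexity.BuzetChailloux (bxor zeroVec bxor_bxor_cancel_left bxor_zeroVec zeroVec_bxor bxor_comm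
  bxor_self)

variable {n : ℕ}

section Engine

variable (V₀ : Finset (Fin n → Bool)) (P : (Fin n → Bool) → Prop) (x₀ : Fin n → Bool) (h : (Fin n → Bool) → Bool)

/-- **Extraction of two orthogonal hyperbolic pairs inside `V₀`.**  If the radical `R` of the relative form `B` satisfies `4·#R < #V₀`,
there are `a₀, a₁, a₂, a₃ ∈ V₀` with `B(a₀,a₁) = B(a₂,a₃) = 1` and `B(aᵢ,aⱼ) = 0` for the four cross pairs.
[cite: MacWilliamsSloane1977, Ch. 15 §2] -/
theorem fr_extract2 (hx₀ : P x₀) (hPV : ∀ x, P x → ∀ a ∈ V₀, P (bxor x a)) (hadd : ∀ a ∈ V₀, ∀ b ∈ V₀, bxor a b ∈ V₀)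
    (hsd : ∀ x, P x → ∀ p ∈ V₀, ∀ q ∈ V₀, h (bxor (bxor x p) q) =
      (h x ^^ h (bxor x p) ^^ h (bxor x q) ^^ (h x₀ ^^ h (bxor x₀ p) ^^ h (bxor x₀ q) ^^ h (bxor (bxor x₀ p) q))))
    (hR : 4 * #(V₀.filter fun a => ∀ b ∈ V₀, (h x₀ ^^ h (bxor x₀ a) ^^ h (bxor x₀ b) ^^ h (bxor (bxor x₀ a) b)) = false) < #V₀) :
    ∃ a₀ ∈ V₀, ∃ a₁ ∈ V₀, ∃ a₂ ∈ V₀, ∃ a₃ ∈ V₀,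
      (h x₀ ^^ h (bxor x₀ a₀) ^^ h (bxor x₀ a₁) ^^ h (bxor (bxor x₀ a₀) a₁)) = true ∧
      (h x₀ ^^ h (bxor x₀ a₂) ^^ h (bxor x₀ a₃) ^^ h (bxor (bxor x₀ a₂) a₃)) = true ∧
      (h x₀ ^^ h (bxor x₀ a₀) ^^ h (bxor x₀ a₂) ^^ h (bxor (bxor x₀ a₀) a₂)) = false ∧
      (h x₀ ^^ h (bxor x₀ a₀) ^^ h (bxor x₀ a₃) ^^ h (bxor (bxor x₀ a₀) a₃)) = false ∧
      (h x₀ ^^ h (bxor x₀ a₁) ^^ h (bxor x₀ a₂) ^^ h (bxor (bxor x₀ a₁) a₂)) = false ∧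
      (h x₀ ^^ h (bxor x₀ a₁) ^^ h (bxor x₀ a₃) ^^ h (bxor (bxor x₀ a₁) a₃)) = false := by
  classical
  set R := V₀.filter (fun a => ∀ b ∈ V₀, (h x₀ ^^ h (bxor x₀ a) ^^ h (bxor x₀ b) ^^ h (bxor (bxor x₀ a) b)) = false)
    with hRdef
  have hsymm := fr_B_symm x₀ h
  have hBadd : ∀ {a a' c : Fin n → Bool}, a ∈ V₀ → a' ∈ V₀ → c ∈ V₀ →
      (h x₀ ^^ h (bxor x₀ (bxor a a')) ^^ h (bxor x₀ c) ^^ h (bxor (bxor x₀ (bxor a a')) c)) =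
        ((h x₀ ^^ h (bxor x₀ a) ^^ h (bxor x₀ c) ^^ h (bxor (bxor x₀ a) c)) ^^
          (h x₀ ^^ h (bxor x₀ a') ^^ h (bxor x₀ c) ^^ h (bxor (bxor x₀ a') c))) :=
    fun ha ha' hc => fr_B_add_left V₀ P x₀ h hx₀ hPV hsd ha ha' hc
  -- a vector of `V₀` outside `R` has a partner in `V₀`
  have hpartner : ∀ a ∈ V₀, a ∉ R → ∃ b ∈ V₀, (h x₀ ^^ h (bxor x₀ a) ^^ h (bxor x₀ b) ^^ h (bxor (bxor x₀ a) b)) = true := by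
    intro a ha haR
    by_contra hno
    push Not at hno
    exact haR (mem_filter.2 ⟨ha, fun b hb => by simpa using hno b hb⟩)
  -- first pair
  obtain ⟨x, hx, x', hx', -, h₀⟩ := fr_diff_outside (γ := Unit) V₀ R (fun _ => ()) (by simp only [Fintype.card_unit]; omega)
  have ha₀ : bxor x x' ∈ V₀ := hadd _ hx _ hx'
  obtain ⟨a₁, ha₁, h01⟩ := hpartner _ ha₀ h₀
  -- second pair: a difference inside a fibre of the two pairings with `a₀, a₁`
  obtain ⟨x₁, hx₁, x₁', hx₁', hφ₁, h₂⟩ := fr_diff_outside (γ := Bool × Bool) V₀ R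
    (fun z => ((h x₀ ^^ h (bxor x₀ z) ^^ h (bxor x₀ (bxor x x')) ^^ h (bxor (bxor x₀ z) (bxor x x'))),
      (h x₀ ^^ h (bxor x₀ z) ^^ h (bxor x₀ a₁) ^^ h (bxor (bxor x₀ z) a₁))))
    (by rw [Fintype.card_prod, Fintype.card_bool]; omega)
  have ha₂ : bxor x₁ x₁' ∈ V₀ := hadd _ hx₁ _ hx₁'
  have h20 : (h x₀ ^^ h (bxor x₀ (bxor x₁ x₁')) ^^ h (bxor x₀ (bxor x x')) ^^ h (bxor (bxor x₀ (bxor x₁ x₁')) (bxor x x')))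
      = false := by
    rw [hBadd hx₁ hx₁' ha₀, (Prod.mk.inj hφ₁).1, Bool.xor_self]
  have h21 : (h x₀ ^^ h (bxor x₀ (bxor x₁ x₁')) ^^ h (bxor x₀ a₁) ^^ h (bxor (bxor x₀ (bxor x₁ x₁')) a₁)) = false := by
    rw [hBadd hx₁ hx₁' ha₁, (Prod.mk.inj hφ₁).2, Bool.xor_self]
  obtain ⟨b₂, hb₂, hb₂'⟩ := hpartner _ ha₂ h₂
  obtain ⟨a₃, ha₃, h30, h31, h3z⟩ := fr_gs V₀ P x₀ h hx₀ hPV hadd hsd ha₀ ha₁ hb₂ h01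
  have h23 : (h x₀ ^^ h (bxor x₀ (bxor x₁ x₁')) ^^ h (bxor x₀ a₃) ^^ h (bxor (bxor x₀ (bxor x₁ x₁')) a₃)) = true := by
    rw [hsymm, h3z _ ha₂ h20 h21, hsymm]; exact hb₂'
  refine ⟨bxor x x', ha₀, a₁, ha₁, bxor x₁ x₁', ha₂, a₃, ha₃, h01, h23, ?_, ?_, ?_, ?_⟩
  · rw [hsymm]; exact h20
  · rw [hsymm]; exact h30
  · rw [hsymm]; exact h21
  · rw [hsymm]; exact h31

/-- From the value of `B(p,q)`, the pair chain `h(x₀ ⊕ p ⊕ q)` in terms of the atoms. [folklore] -/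
theorem fr_pair_of_B {p q : Fin n → Bool} {v : Bool}
    (hB : (h x₀ ^^ h (bxor x₀ p) ^^ h (bxor x₀ q) ^^ h (bxor (bxor x₀ p) q)) = v) :
    h (bxor (bxor x₀ p) q) = (h x₀ ^^ h (bxor x₀ p) ^^ h (bxor x₀ q) ^^ v) := by
  revert hB
  cases h x₀ <;> cases h (bxor x₀ p) <;> cases h (bxor x₀ q) <;> cases h (bxor (bxor x₀ p) q) <;> cases v <;> decide

/-- **The radical is large.**  Under (H3) and (H4) (all parametrised 3-flat sign sums `≡ 0 (mod 4)` and 4-flat sign sums `≡ 0 (mod 8)`,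
base in `S`, directions in `V₀`), the radical `R` of the relative form satisfies `#V₀ ≤ 4·#R` — i.e. `h` has rank `≤ 2` along `S`.
(Otherwise two orthogonal hyperbolic pairs give a 4-flat on which `h = ε₀ε₁ ⊕ ε₂ε₃ ⊕ affine`, sign sum `±4`.) [this work] -/
theorem fr_radical_large (hadd : ∀ a ∈ V₀, ∀ b ∈ V₀, bxor a b ∈ V₀) (hx₀ : P x₀)
    (hPV : ∀ x, P x → ∀ a ∈ V₀, P (bxor x a)) (hVP : ∀ x, P x → bxor x₀ x ∈ V₀)
    (H3 : ∀ x, P x → ∀ a b c : Fin n → Bool, a ∈ V₀ → b ∈ V₀ → c ∈ V₀ →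
      (4 : ℤ) ∣ ∑ ε : Fin 3 → Bool, sZ (h (fun j => x j ^^ decide (Odd #(univ.filter fun i =>
        ε i && (![a, b, c] : Fin 3 → Fin n → Bool) i j)))))
    (H4 : ∀ x, P x → ∀ a₀ a₁ a₂ a₃ : Fin n → Bool, a₀ ∈ V₀ → a₁ ∈ V₀ → a₂ ∈ V₀ → a₃ ∈ V₀ →
      (8 : ℤ) ∣ ∑ ε : Fin 4 → Bool, sZ (h (fun j => x j ^^ decide (Odd #(univ.filter fun i =>
        ε i && (![a₀, a₁, a₂, a₃] : Fin 4 → Fin n → Bool) i j))))) :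
    #V₀ ≤ 4 * #(V₀.filter fun a => ∀ b ∈ V₀, (h x₀ ^^ h (bxor x₀ a) ^^ h (bxor x₀ b) ^^ h (bxor (bxor x₀ a) b)) = false) := by
  classical
  have hsd := fr_hsd V₀ P x₀ hx₀ hVP h H3
  by_contra hlt
  push Not at hlt
  obtain ⟨a₀, ha₀, a₁, ha₁, a₂, ha₂, a₃, ha₃, h01, h23, h02, h03, h12, h13⟩ :=
    fr_extract2 V₀ P x₀ h hx₀ hPV hadd hsd hlt
  have hsymm := fr_B_symm x₀ h
  have H := H4 x₀ hx₀ a₀ a₁ a₂ a₃ ha₀ ha₁ ha₂ ha₃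
  have e4 := fr_sum4 (fun y => sZ (h y)) x₀ a₀ a₁ a₂ a₃
  beta_reduce at e4
  rw [e4] at H
  -- pair chains from the six `B`-values
  have h10 : (h x₀ ^^ h (bxor x₀ a₁) ^^ h (bxor x₀ a₀) ^^ h (bxor (bxor x₀ a₁) a₀)) = true := by rw [hsymm]; exact h01
  have h20' : (h x₀ ^^ h (bxor x₀ a₂) ^^ h (bxor x₀ a₀) ^^ h (bxor (bxor x₀ a₂) a₀)) = false := by rw [hsymm]; exact h02
  have h21' : (h x₀ ^^ h (bxor x₀ a₂) ^^ h (bxor x₀ a₁) ^^ h (bxor (bxor x₀ a₂) a₁)) = false := by rw [hsymm]; exact h12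
  have h30' : (h x₀ ^^ h (bxor x₀ a₃) ^^ h (bxor x₀ a₀) ^^ h (bxor (bxor x₀ a₃) a₀)) = false := by rw [hsymm]; exact h03
  have h31' : (h x₀ ^^ h (bxor x₀ a₃) ^^ h (bxor x₀ a₁) ^^ h (bxor (bxor x₀ a₃) a₁)) = false := by rw [hsymm]; exact h13
  have h32' : (h x₀ ^^ h (bxor x₀ a₃) ^^ h (bxor x₀ a₂) ^^ h (bxor (bxor x₀ a₃) a₂)) = true := by rw [hsymm]; exact h23
  have p10 := fr_pair_of_B x₀ h h10
  have p20 := fr_pair_of_B x₀ h h20'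
  have p21 := fr_pair_of_B x₀ h h21'
  have p30 := fr_pair_of_B x₀ h h30'
  have p31 := fr_pair_of_B x₀ h h31'
  have p32 := fr_pair_of_B x₀ h h32'
  -- triple and quadruple chains by the base-free second differences
  have hP2 : P (bxor x₀ a₂) := hPV _ hx₀ _ ha₂
  have hP3 : P (bxor x₀ a₃) := hPV _ hx₀ _ ha₃
  have hP32 : P (bxor (bxor x₀ a₃) a₂) := hPV _ hP3 _ ha₂
  have t210 := hsd _ hP2 a₁ ha₁ a₀ ha₀
  have t310 := hsd _ hP3 a₁ ha₁ a₀ ha₀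
  have t320 := hsd _ hP3 a₂ ha₂ a₀ ha₀
  have t321 := hsd _ hP3 a₂ ha₂ a₁ ha₁
  have q3210 := hsd _ hP32 a₁ ha₁ a₀ ha₀
  rw [q3210] at H
  rw [t210, t310, t320, t321] at H
  rw [p10, p20, p21, p30, p31, p32] at H
  revert H
  generalize h x₀ = c
  generalize h (bxor x₀ a₀) = d₀
  generalize h (bxor x₀ a₁) = d₁
  generalize h (bxor x₀ a₂) = d₂
  generalize h (bxor x₀ a₃) = d₃
  revert c d₀ d₁ d₂ d₃
  decide

/-- `0 ∈ R`. [folklore] -/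
theorem fr_radical_zero_mem (h0 : zeroVec ∈ V₀) :
    zeroVec ∈ V₀.filter (fun a => ∀ b ∈ V₀, (h x₀ ^^ h (bxor x₀ a) ^^ h (bxor x₀ b) ^^ h (bxor (bxor x₀ a) b)) = false) := by
  refine mem_filter.2 ⟨h0, fun b _ => ?_⟩
  rw [bxor_zeroVec]
  cases h x₀ <;> cases h (bxor x₀ b) <;> rfl

/-- `R` is `⊕`-closed (bi-additivity). [folklore] -/
theorem fr_radical_add (hx₀ : P x₀) (hPV : ∀ x, P x → ∀ a ∈ V₀, P (bxor x a)) (hadd : ∀ a ∈ V₀, ∀ b ∈ V₀, bxor a b ∈ V₀)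
    (hsd : ∀ x, P x → ∀ p ∈ V₀, ∀ q ∈ V₀, h (bxor (bxor x p) q) =
      (h x ^^ h (bxor x p) ^^ h (bxor x q) ^^ (h x₀ ^^ h (bxor x₀ p) ^^ h (bxor x₀ q) ^^ h (bxor (bxor x₀ p) q)))) :
    ∀ a ∈ V₀.filter (fun a => ∀ b ∈ V₀, (h x₀ ^^ h (bxor x₀ a) ^^ h (bxor x₀ b) ^^ h (bxor (bxor x₀ a) b)) = false),
    ∀ a' ∈ V₀.filter (fun a => ∀ b ∈ V₀, (h x₀ ^^ h (bxor x₀ a) ^^ h (bxor x₀ b) ^^ h (bxor (bxor x₀ a) b)) = false),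
      bxor a a' ∈ V₀.filter (fun a => ∀ b ∈ V₀, (h x₀ ^^ h (bxor x₀ a) ^^ h (bxor x₀ b) ^^ h (bxor (bxor x₀ a) b)) = false) := by
  intro a ha a' ha'
  refine mem_filter.2 ⟨hadd _ (mem_filter.1 ha).1 _ (mem_filter.1 ha').1, fun b hb => ?_⟩
  rw [fr_B_add_left V₀ P x₀ h hx₀ hPV hsd (mem_filter.1 ha).1 (mem_filter.1 ha').1 hb, (mem_filter.1 ha).2 b hb,
    (mem_filter.1 ha').2 b hb]
  rfl

/-- **Radical vectors are periods up to sign on the coset**: for `a ∈ R` and `x ∈ S`, `h(x ⊕ a) = h(x) ⊕ (h(x₀) ⊕ h(x₀ ⊕ a))`.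
[this work] -/
theorem fr_radical_period (hx₀ : P x₀) (hVP : ∀ x, P x → bxor x₀ x ∈ V₀)
    (hsd : ∀ x, P x → ∀ p ∈ V₀, ∀ q ∈ V₀, h (bxor (bxor x p) q) =
      (h x ^^ h (bxor x p) ^^ h (bxor x q) ^^ (h x₀ ^^ h (bxor x₀ p) ^^ h (bxor x₀ q) ^^ h (bxor (bxor x₀ p) q))))
    {a : Fin n → Bool}
    (ha : a ∈ V₀.filter (fun a => ∀ b ∈ V₀, (h x₀ ^^ h (bxor x₀ a) ^^ h (bxor x₀ b) ^^ h (bxor (bxor x₀ a) b)) = false))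
    {x : Fin n → Bool} (hx : P x) : h (bxor x a) = (h x ^^ (h x₀ ^^ h (bxor x₀ a))) := by
  have hc : bxor x₀ x ∈ V₀ := hVP x hx
  have hBa : (h x₀ ^^ h (bxor x₀ a) ^^ h (bxor x₀ (bxor x₀ x)) ^^ h (bxor (bxor x₀ a) (bxor x₀ x))) = false :=
    (mem_filter.1 ha).2 _ hc
  have key := hsd x₀ hx₀ (bxor x₀ x) hc a (mem_filter.1 ha).1
  rw [fr_B_symm x₀ h (bxor x₀ x) a, hBa, bxor_bxor_cancel_left] at key
  rw [key]
  cases h x₀ <;> cases h x <;> cases h (bxor x₀ a) <;> rfl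

end Engine

end Summit.QuantumAdvantage.QuantumAdvantage.Theorems.CubicForrelation.NearExactIsExact

end
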